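import Literature.Computability.Cryptography.PeriodFindingRule
import HarnessLib

/-!
# Product laws: independence of events on disjoint sets of units, and amplification over pairs

Topic `Computability/Cryptography`; continues `PeriodFindingRule.lean` (the vocabulary `pw`, `prob`,
`IsProbVec` of finite product laws over units `U` with outcome types `X u`, and its one- and
two-coordinate marginals). The analysis of Hallgren's algorithm in the tree's period-finding family
reads TWO units (two Fourier samples at the same transform size, Jozsa 2003 §10: "we run the
algorithm twice … if `k₁, k₂` are coprime", then amplification over many disjoint pairs of units), so
we need the general fact behind the marginals of `PeriodFindingRule.lean`:

* **`prob_and_eq_mul`** — under a product law, an event depending only on the coordinates in `T`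
  and an event depending only on the coordinates outside `T` are independent (elementary: split
  `∏_u` along `T`, the indicator of each event is constant in the other block of coordinates);
* `prob_exists_disjoint_eq_sum` — additivity over pairwise disjoint events;
* **`prob_forall_not_eq_prod`** / **`prob_forall_not_le_pow`** — for events `E_i` on pairwise
  disjoint PAIRS of units `(a_i, b_i)`, `P(∀ i, ¬E_i) = ∏_i (1 − P(E_i)) ≤ (1 − p)^{#ι}` when every
  `P(E_i) ≥ p`; `prob_pair_eq_mul` — `P(γ_a ∈ D ∧ γ_b ∈ D') = P(γ_a ∈ D) P(γ_b ∈ D')` for `a ≠ b`.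

Theorem file, no named facts.

## References

* R. Jozsa, arXiv:quant-ph/0302134 (2003), §10 (two runs; repetition). [Jozsa2003]
* A. Yu. Kitaev, arXiv:quant-ph/9511026 (1995), §3 Lemma 8 (independent tests). [Kitaev1995]
-/

noncomputable section

namespace Literature.Computability.Cryptography

namespace PeriodFinding

open Finset

variable {U : Type*} [Fintype U] [DecidableEq U] {X : U → Type*} [∀ u, Fintype (X u)] [∀ u, DecidableEq (X u)]
  {μ : (u : U) → X u → ℝ}

/-! ### Independence of events on disjoint sets of units -/

omit [∀ u, DecidableEq (X u)] in
/-- **Independence of disjoint blocks of units.** If `A` depends only on the coordinates in `T` and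
`B` only on the coordinates outside `T`, then `P(A ∧ B) = P(A) · P(B)` under a product law.
[cite: Kitaev1995, §3 Lemma 8 (independent tests)] -/
theorem prob_and_eq_mul (hμ : IsProbVec μ) (T : Finset U) {A B : ((u : U) → X u) → Prop}
    [DecidablePred A] [DecidablePred B]
    (hA : ∀ γ γ' : (u : U) → X u, (∀ u ∈ T, γ u = γ' u) → (A γ ↔ A γ'))
    (hB : ∀ γ γ' : (u : U) → X u, (∀ u ∉ T, γ u = γ' u) → (B γ ↔ B γ')) :
    prob μ (univ.filter fun γ => A γ ∧ B γ) = prob μ (univ.filter A) * prob μ (univ.filter B) := by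
  classical
  -- split the coordinates along `T`
  set e := Equiv.piEquivPiSubtypeProd (fun u => u ∈ T) X with he
  set w₁ : ((u : {u // u ∈ T}) → X u) → ℝ := fun a => ∏ i : {u // u ∈ T}, μ i.1 (a i) with hw₁
  set w₂ : ((u : {u // u ∉ T}) → X u) → ℝ := fun b => ∏ i : {u // u ∉ T}, μ i.1 (b i) with hw₂
  have hpw : ∀ γ : (u : U) → X u, pw μ γ = w₁ (e γ).1 * w₂ (e γ).2 := by
    intro γ
    unfold pw
    rw [← Fintype.prod_subtype_mul_prod_subtype (fun u => u ∈ T) (fun u => μ u (γ u)), hw₁, hw₂, he]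
    simp only [Equiv.piEquivPiSubtypeProd_apply]
    congr 1; convert rfl
  set IA : ((u : {u // u ∈ T}) → X u) → ((u : {u // u ∉ T}) → X u) → ℝ :=
    fun a b => if A (e.symm (a, b)) then 1 else 0 with hIA
  set IB : ((u : {u // u ∈ T}) → X u) → ((u : {u // u ∉ T}) → X u) → ℝ :=
    fun a b => if B (e.symm (a, b)) then 1 else 0 with hIB
  -- indicators are constant in the other block
  have hIAc : ∀ a b b', IA a b = IA a b' := by
    intro a b b'
    have : A (e.symm (a, b)) ↔ A (e.symm (a, b')) := hA _ _ fun u hu => by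
      simp [he, Equiv.piEquivPiSubtypeProd, hu]
    simp only [hIA, this]
  have hIBc : ∀ a a' b, IB a b = IB a' b := by
    intro a a' b
    have : B (e.symm (a, b)) ↔ B (e.symm (a', b)) := hB _ _ fun u hu => by
      simp [he, Equiv.piEquivPiSubtypeProd, hu]
    simp only [hIB, this]
  -- block totals are one
  have htot₁ : ∑ a, w₁ a = 1 := by
    rw [hw₁, ← Fintype.prod_sum]
    exact prod_eq_one fun i _ => hμ.total i
  have htot₂ : ∑ b, w₂ b = 1 := by
    rw [hw₂, ← Fintype.prod_sum]
    exact prod_eq_one fun i _ => hμ.total i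
  -- any filtered probability as a double sum over the blocks
  have hprob : ∀ (P : ((u : U) → X u) → Prop) [DecidablePred P],
      prob μ (univ.filter P) = ∑ a, ∑ b, w₁ a * w₂ b * (if P (e.symm (a, b)) then 1 else 0) := by
    intro P _
    unfold prob
    rw [sum_filter, ← Fintype.sum_prod_type', ← e.symm.sum_comp]
    refine sum_congr rfl fun q _ => ?_
    rw [hpw, Equiv.apply_symm_apply]
    split_ifs <;> simp
  set α : ((u : {u // u ∈ T}) → X u) → ℝ := fun a => ∑ b, w₂ b * IA a b with hα
  set β : ((u : {u // u ∉ T}) → X u) → ℝ := fun b => ∑ a, w₁ a * IB a b with hβ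
  have hIAα : ∀ a b, IA a b = α a := by
    intro a b
    rw [hα]
    simp only
    rw [sum_congr rfl fun b' _ => by rw [hIAc a b' b], ← sum_mul, htot₂, one_mul]
  have hIBβ : ∀ a b, IB a b = β b := by
    intro a b
    rw [hβ]
    simp only
    rw [sum_congr rfl fun a' _ => by rw [hIBc a' a b], ← sum_mul, htot₁, one_mul]
  have hAnd : ∀ a b, (if (A (e.symm (a, b)) ∧ B (e.symm (a, b))) then (1 : ℝ) else 0) = IA a b * IB a b := by
    intro a b
    simp only [hIA, hIB]
    by_cases h1 : A (e.symm (a, b)) <;> by_cases h2 : B (e.symm (a, b)) <;> simp [h1, h2]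
  rw [hprob (fun γ => A γ ∧ B γ), hprob A, hprob B]
  simp_rw [hAnd]
  have hL : ∑ a, ∑ b, w₁ a * w₂ b * (IA a b * IB a b) = (∑ a, w₁ a * α a) * ∑ b, w₂ b * β b := by
    rw [sum_mul_sum]
    refine sum_congr rfl fun a _ => sum_congr rfl fun b _ => ?_
    rw [hIAα a b, hIBβ a b]; ring
  have hRA : ∑ a, ∑ b, w₁ a * w₂ b * (if A (e.symm (a, b)) then 1 else 0) = ∑ a, w₁ a * α a := by
    refine sum_congr rfl fun a _ => ?_
    rw [hα]
    simp only [hIA, mul_sum]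
    refine sum_congr rfl fun b _ => ?_
    ring
  have hRB : ∑ a, ∑ b, w₁ a * w₂ b * (if B (e.symm (a, b)) then 1 else 0) = ∑ b, w₂ b * β b := by
    rw [sum_comm]
    refine sum_congr rfl fun b _ => ?_
    rw [hβ]
    simp only [hIB, mul_sum]
    refine sum_congr rfl fun a _ => ?_
    ring
  rw [hL, hRA, hRB]

/-- The two-unit case: `P(γ_a ∈ D ∧ γ_b ∈ D') = P(γ_a ∈ D) · P(γ_b ∈ D')` for `a ≠ b`. [cite: Kitaev1995, §3 Lemma 8] -/
theorem prob_pair_eq_mul (hμ : IsProbVec μ) {a b : U} (hab : a ≠ b) (D : Finset (X a)) (D' : Finset (X b)) :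
    prob μ (univ.filter fun γ => γ a ∈ D ∧ γ b ∈ D') =
      prob μ (univ.filter fun γ => γ a ∈ D) * prob μ (univ.filter fun γ => γ b ∈ D') :=
  prob_and_eq_mul hμ {a} (fun γ γ' h => by rw [h a (mem_singleton_self a)])
    (fun γ γ' h => by rw [h b (by simpa using Ne.symm hab)])

/-! ### Additivity over disjoint events -/

/-- **Additivity**: the probability of a disjoint finite union of events is the sum. [folklore] -/
theorem prob_exists_disjoint_eq_sum {κ : Type*} (C : Finset κ) (E : κ → ((u : U) → X u) → Prop)
    [∀ k, DecidablePred (E k)] (hdis : ∀ k ∈ C, ∀ k' ∈ C, k ≠ k' → ∀ γ, ¬ (E k γ ∧ E k' γ)) :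
    prob μ (univ.filter fun γ => ∃ k ∈ C, E k γ) = ∑ k ∈ C, prob μ (univ.filter (E k)) := by
  classical
  have hU : (univ.filter fun γ : (u : U) → X u => ∃ k ∈ C, E k γ) = C.biUnion fun k => univ.filter (E k) := by
    ext γ; simp
  rw [hU, prob, sum_biUnion]
  · rfl
  · intro k hk k' hk' hkk'
    rw [Function.onFun, disjoint_left]
    intro γ h1 h2
    exact hdis k hk k' hk' hkk' γ ⟨(mem_filter.1 h1).2, (mem_filter.1 h2).2⟩

/-! ### Amplification over pairwise disjoint pairs of units -/

section Pairs

variable {ι : Type*} [Fintype ι] [DecidableEq ι] (a b : ι → U)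

/-- Pairwise disjoint pairs of units: the `2 #ι` units `a_i, b_i` are distinct. [folklore] -/
structure DisjointPairs : Prop where
  /-- first components distinct -/
  inj_a : Function.Injective a
  /-- second components distinct -/
  inj_b : Function.Injective b
  /-- no first component is a second component -/
  a_ne_b : ∀ i j, a i ≠ b j

variable {a b}

/-- **Failure of every pair is a product**: for events `E_i` on the pairs,
`P(∀ i ∈ s, ¬E_i(γ_{a_i}, γ_{b_i})) = ∏_{i ∈ s} (1 − P(E_i))`. [cite: Jozsa2003, §10 (independent repetitions)] -/
theorem prob_forall_not_eq_prod (hμ : IsProbVec μ) (hab : DisjointPairs a b)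
    (E : (i : ι) → X (a i) → X (b i) → Prop) [∀ i x y, Decidable (E i x y)] (s : Finset ι) :
    prob μ (univ.filter fun γ => ∀ i ∈ s, ¬ E i (γ (a i)) (γ (b i))) =
      ∏ i ∈ s, (1 - prob μ (univ.filter fun γ => E i (γ (a i)) (γ (b i)))) := by
  classical
  induction s using Finset.induction_on with
  | empty =>
    rw [prod_empty]
    have : (univ.filter fun γ : (u : U) → X u => ∀ i ∈ (∅ : Finset ι), ¬ E i (γ (a i)) (γ (b i))) = univ := by
      ext γ; simp
    rw [this]
    exact prob_univ hμ
  | @insert i s hi ih =>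
    rw [prod_insert hi, ← ih]
    have hsplit : (univ.filter fun γ : (u : U) → X u => ∀ j ∈ insert i s, ¬ E j (γ (a j)) (γ (b j))) =
        univ.filter fun γ => (¬ E i (γ (a i)) (γ (b i))) ∧ ∀ j ∈ s, ¬ E j (γ (a j)) (γ (b j)) := by
      ext γ; simp [forall_and, or_imp]
    rw [hsplit, prob_and_eq_mul hμ ({a i, b i} : Finset U)]
    · congr 1
      have := prob_compl hμ (univ.filter fun γ : (u : U) → X u => E i (γ (a i)) (γ (b i)))
      rw [← this]
      congr 1
      ext γ; simp
    · intro γ γ' h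
      rw [h (a i) (by simp), h (b i) (by simp)]
    · intro γ γ' h
      have ha : ∀ j ∈ s, γ (a j) = γ' (a j) := fun j hj => h (a j) (by
        simp only [mem_insert, mem_singleton, not_or]
        exact ⟨fun e => hi (hab.inj_a e ▸ hj), hab.a_ne_b j i⟩)
      have hb : ∀ j ∈ s, γ (b j) = γ' (b j) := fun j hj => h (b j) (by
        simp only [mem_insert, mem_singleton, not_or]
        exact ⟨fun e => hab.a_ne_b i j e.symm, fun e => hi (hab.inj_b e ▸ hj)⟩)
      constructor
      · intro H j hj; rw [← ha j hj, ← hb j hj]; exact H j hj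
      · intro H j hj; rw [ha j hj, hb j hj]; exact H j hj

/-- **Amplification over disjoint pairs**: if every pair event has probability `≥ p`, then all of
them fail with probability `≤ (1 − p)^{#s}`. [cite: Jozsa2003, §10 (repeat to amplify)] -/
theorem prob_forall_not_le_pow (hμ : IsProbVec μ) (hab : DisjointPairs a b)
    (E : (i : ι) → X (a i) → X (b i) → Prop) [∀ i x y, Decidable (E i x y)] (s : Finset ι) {p : ℝ}
    (hp : ∀ i ∈ s, p ≤ prob μ (univ.filter fun γ => E i (γ (a i)) (γ (b i)))) :
    prob μ (univ.filter fun γ => ∀ i ∈ s, ¬ E i (γ (a i)) (γ (b i))) ≤ (1 - p) ^ s.card := by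
  rw [prob_forall_not_eq_prod hμ hab E s]
  calc ∏ i ∈ s, (1 - prob μ (univ.filter fun γ => E i (γ (a i)) (γ (b i))))
      ≤ ∏ _i ∈ s, (1 - p) :=
        prod_le_prod (fun i _ => by linarith [prob_le_one hμ (univ.filter fun γ => E i (γ (a i)) (γ (b i)))])
          fun i hi => by linarith [hp i hi]
    _ = (1 - p) ^ s.card := prod_const _

/-- **Some pair succeeds** with probability `≥ 1 − (1 − p)^{#s}`. [cite: Jozsa2003, §10] -/
theorem prob_exists_pair_ge (hμ : IsProbVec μ) (hab : DisjointPairs a b)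
    (E : (i : ι) → X (a i) → X (b i) → Prop) [∀ i x y, Decidable (E i x y)] (s : Finset ι) {p : ℝ}
    (hp : ∀ i ∈ s, p ≤ prob μ (univ.filter fun γ => E i (γ (a i)) (γ (b i)))) :
    1 - (1 - p) ^ s.card ≤ prob μ (univ.filter fun γ => ∃ i ∈ s, E i (γ (a i)) (γ (b i))) := by
  classical
  have h1 := prob_forall_not_le_pow hμ hab E s hp
  have h2 := prob_compl hμ (univ.filter fun γ : (u : U) → X u => ∃ i ∈ s, E i (γ (a i)) (γ (b i)))
  have hc : (univ.filter fun γ : (u : U) → X u => ∃ i ∈ s, E i (γ (a i)) (γ (b i)))ᶜ =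
      univ.filter fun γ => ∀ i ∈ s, ¬ E i (γ (a i)) (γ (b i)) := by
    ext γ; simp
  rw [hc] at h2
  linarith

end Pairs

end PeriodFinding

end Literature.Computability.Cryptography

end
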